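import Mathlib
import HarnessLib.Audit
import Summits.PneNP.PneNP.Theorems.PstarNorUnitEQ1Tools

/-!
# An (EXC) chord is a CONS-T unit or secretly (EQ) (ROUND-24, memo §9 R7/R8 — the elliptic residue (c2) per chord)

FRONTIER range-avoidance ladder, rung F-N3, ROUND 24 (cell `pnp-ideate`, planner memo `r24/CORE-BOUND-NOTES.md` §9 R5–R8, §10; restricted-model proof
complexity — nothing here bears on `P` versus `NP`).

The (EXC) disjunct of `PstarChordBridgeBasis.forced_chord_cases_dir` / `regime_cases` says `Q_{D e} = q_m + μ₁μ₂ + κ` (`μ₁, μ₂` affine).  Together with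
the (★★) containment `Z(q_m) ⊆ {Q_{D e} = γ_e + 1}` it came from, this is as rigid as the (NOR) case — `exc_unit_of_dir`:

* `μ₁μ₂ ≡ d := γ_e + 1 + κ` on `Z(q_m)`;
* if the linear parts of `μ₁, μ₂` are dependent, `μ₁μ₂` is affine: either `Q_{D e} = q_m + κ'` ((EQ) after all) or `Z(q_m)` lies in a hyperplane,
  `q_m + 1 = λ·m` (`PstarCubeIdeals.exists_affine_mul_of_hyperplane`) and `Q_{D e} = λ(m+1) + const` has rank `≤ 2` — impossible (`rank_four_of_wf`);
* independent and `d = 1`: `Z(q_m) ⊆ {μ₁ = 1}`, so `q_m + 1 = μ₁·m` and `Q_{D e} = μ₁(m + μ₂) + const` — impossible again;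
* independent and `d = 0`: `q_m + 1` vanishes on the flat `{μ₁ = μ₂ = 1}`, so `q_m + 1 = (μ₁+1)a₁ + (μ₂+1)a₂` (`exists_affine_of_codimTwo`) and, since
  `μ₁μ₂ = (μ₁+1)μ₂ + (μ₂+1) + 1`, `Q_{D e} + κ = (μ₁+1)(a₁+μ₂) + (μ₂+1)(a₂+1)` — the hypothesis of `PstarNorUnitNA.nor_unit_na` verbatim; its gadget
  hypothesis holds because `polar(Q_{D e}) = polarDir + ℓ₁∧ℓ₂` vanishes off the AND pairs of `D e` (`PstarNorUnitDir.exists_realiser_of_polarDir`).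

So `D e` is a CONS-T pair `{(σ,b),(τ,b′)}` with single literals `{σ,τ} = supp ℓ₁ ∪ supp ℓ₂` and a realiser of `{σ,τ}` among the joins / private-free
pendants — or the chord is (EQ).  `exc_unit_of_regime` derives the `Z`-hypothesis from the chord system (as `forced_chord_cases_dir` does:
`U1_package` + `star_star`).
-/

set_option linter.dupNamespace false -- `Summit.PneNP.PneNP.…`: summit = sub-problem name (D-0017 single-conjunct layout)

open Finset Module Literature.Computability.Complexity
open Summit.PneNP.PneNP.Theorems.PstarSALevel (varSet bdry BoundaryExpanding SimpleOverlap)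
open Summit.PneNP.PneNP.Theorems.PstarGapLinearised (andPair)
open Summit.PneNP.PneNP.Theorems.PstarChordEndgameTools (mem_andPair_iff)
open Summit.PneNP.PneNP.Theorems.PstarCubeIdeals (IsAffineFn IsQuadFn isAffineFn_const exists_affine_of_codimTwo exists_affine_mul_of_hyperplane
  flips_of_affine exists_dual_of_affine)
open Summit.PneNP.PneNP.Theorems.PstarQuadRank (rad)
open Summit.PneNP.PneNP.Theorems.PstarRankRigidityTwo (linPart symForm symForm_apply linPart_apply affine_mul_polar)
open Summit.PneNP.PneNP.Theorems.PstarForcing (polar_unique not_rank_four_of_mul)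
open Summit.PneNP.PneNP.Theorems.PstarProductRank (qform polar)
open Summit.PneNP.PneNP.Theorems.PstarPathRank (AndAdj polar_basis)
open Summit.PneNP.PneNP.Theorems.PstarChordSystem (ChordSystem)
open Summit.PneNP.PneNP.Theorems.PstarChordSystemMap (mapSys toX mapSys_u U1_package)
open Summit.PneNP.PneNP.Theorems.PstarChordBridgeTools (xpdeg)
open Summit.PneNP.PneNP.Theorems.PstarChordBridge (BridgeData sys)
open Summit.PneNP.PneNP.Theorems.PstarReadSumset (V2)
open Summit.PneNP.PneNP.Theorems.PstarChordBridgeForcing (freeMon freePolar gam sys_u_eq qform_add' rank_four_of_wf)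
open Summit.PneNP.PneNP.Theorems.PstarChordBridgeBasis (qDir polarDir q_dir)
open Summit.PneNP.PneNP.Theorems.PstarChordBridgeCorner (qDir_add)
open Summit.PneNP.PneNP.Theorems.PstarNorUnitNA (nor_unit_na)
open Summit.PneNP.PneNP.Theorems.PstarNorUnitBridge (xor_not_mem_bdry_of_even)
open Summit.PneNP.PneNP.Theorems.PstarNorUnitDir (exists_realiser_of_polarDir)

namespace Summit.PneNP.PneNP.Theorems.PstarNorUnitExc

variable {n m : ℕ}

/-- **An (EXC) chord is a CONS-T unit or (EQ).**  See the module docstring.  Hypotheses beyond the bridge data: `#(J₀ ∪ G₁ ∪ G₂) ≤ r`,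
`e ∉ G₁ ∪ G₂`, the (★★) containment `Z(q_m) ⊆ {Q_{D e} = γ_e + 1}`, and the (EXC) identity. -/
theorem exc_unit_of_dir (I : LocalMap 4 n m) (hI : I.IsPure xorAndPred) (hS : SimpleOverlap I) {r : ℕ} (hB : BoundaryExpanding r I)
    {B : BridgeData n m} (hW : B.WF I) (hr : (B.J₀ ∪ B.G₁ ∪ B.G₂).card ≤ r) {e : Fin m} (he : e ∈ B.N) (heG : e ∉ B.G₁ ∪ B.G₂) (mv : V2)
    (hZ : ∀ x, qDir I B mv x = 0 → qform (B.D e) (fun j => I.vars j 2) (fun j => I.vars j 3) x = gam B e + 1)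
    {μ₁ μ₂ : (Fin n → ZMod 2) → ZMod 2} (hμ₁ : IsAffineFn μ₁) (hμ₂ : IsAffineFn μ₂) {κ : ZMod 2}
    (hEXC : ∀ x, qform (B.D e) (fun j => I.vars j 2) (fun j => I.vars j 3) x = qDir I B mv x + μ₁ x * μ₂ x + κ) :
    (∃ κ' : ZMod 2, ∀ x, qform (B.D e) (fun j => I.vars j 2) (fun j => I.vars j 3) x = qDir I B mv x + κ') ∨
    (∃ j₁ j₂ : Fin m, ∃ σ τ : Fin n, j₁ ≠ j₂ ∧ B.D e = {j₁, j₂} ∧ Disjoint (andPair I j₁) (andPair I j₂) ∧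
      σ ∈ andPair I j₁ ∧ τ ∈ andPair I j₂ ∧
      (∀ v : Fin n, (μ₁ (Pi.single v 1) ≠ μ₁ 0 ∨ μ₂ (Pi.single v 1) ≠ μ₂ 0) ↔ (v = σ ∨ v = τ)) ∧
      ∃ g ∈ B.T₁ ∪ freeMon I B.N B.G₁ ∪ (B.T₂ ∪ freeMon I B.N B.G₂), σ ∈ andPair I g ∧ τ ∈ andPair I g) := by
  classical
  have z01 : ∀ a : ZMod 2, a = 0 ∨ a = 1 := by decide
  have heD : e ∉ B.D e := fun h => (mem_sdiff.1 (hW.hD e he h)).2 he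
  have hJr : B.J₀.card ≤ r := (card_le_card (subset_union_left.trans subset_union_left)).trans hr
  have hB' := qform_add' I (B.D e)
  have hqB : ∀ x w, qDir I B mv (x + w) = qDir I B mv x + qDir I B mv w + qDir I B mv 0 + polarDir I B mv x w := qDir_add I B mv
  have hrank := rank_four_of_wf I hI hS hB hW hJr he
  have hquad : IsQuadFn (fun x => qDir I B mv x + 1) := by
    refine ⟨polarDir I B mv, fun x w => ?_⟩
    show qDir I B mv (x + w) + 1 = qDir I B mv x + 1 + (qDir I B mv w + 1) + (qDir I B mv 0 + 1) + polarDir I B mv x w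
    rw [hqB]
    generalize qDir I B mv x = s; generalize qDir I B mv w = s'; generalize qDir I B mv 0 = s₀
    generalize polarDir I B mv x w = t
    revert s s' s₀ t; decide
  -- the value of `μ₁μ₂` on `Z`
  set d : ZMod 2 := gam B e + 1 + κ with hd
  have hdZ : ∀ x, qDir I B mv x = 0 → μ₁ x * μ₂ x = d := by
    intro x hx
    have h1 := hZ x hx
    rw [hEXC x, hx, zero_add] at h1
    have e1 : ∀ p k g : ZMod 2, p + k = g + 1 → p = g + 1 + k := by decide
    exact e1 _ _ _ h1
  -- off the `d`-level set of `μ₁μ₂`, `q_m = 1`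
  have hoff : ∀ x, μ₁ x * μ₂ x ≠ d → qDir I B mv x + 1 = 0 := by
    intro x hx
    rcases z01 (qDir I B mv x) with h0 | h1
    · exact absurd (hdZ x h0) hx
    · rw [h1]; decide
  by_cases hind : (∃ a, μ₁ a ≠ μ₁ 0 ∧ μ₂ a = μ₂ 0) ∧ (∃ b, μ₁ b = μ₁ 0 ∧ μ₂ b ≠ μ₂ 0)
  · -- independent linear parts: dual directions
    obtain ⟨⟨a, ha⟩, ⟨b, hb⟩⟩ := hind
    obtain ⟨h₁₁, h₂₁, h₁₂, h₂₂⟩ := exists_dual_of_affine hμ₁ hμ₂ ha hb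
    rcases z01 d with hd0 | hd1
    · -- `d = 0`: `q_m + 1` vanishes on the flat `{μ₁ + 1 = μ₂ + 1 = 0}`
      right
      have hflatZ : ∀ x, μ₁ x + 1 = 0 → μ₂ x + 1 = 0 → qDir I B mv x + 1 = 0 := by
        intro x h1 h2
        refine hoff x ?_
        rw [hd0]
        have e2 : ∀ u v : ZMod 2, u + 1 = 0 → v + 1 = 0 → u * v ≠ 0 := by decide
        exact e2 _ _ h1 h2
      have hl₂' : IsAffineFn (fun x => μ₂ x + 1) := by
        intro x w
        show μ₂ (x + w) + 1 = μ₂ x + 1 + (μ₂ w + 1) + (μ₂ 0 + 1)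
        rw [hμ₂]
        generalize μ₂ x = s; generalize μ₂ w = s'; generalize μ₂ 0 = s₀
        revert s s' s₀; decide
      obtain ⟨a₁, a₂, ha₁, ha₂, hrep⟩ := exists_affine_of_codimTwo (f := fun x => qDir I B mv x + 1)
        (l₁ := fun x => μ₁ x + 1) (l₂ := fun x => μ₂ x + 1) (v₁ := a) (v₂ := b)
        (fun x => by show μ₁ (x + a) + 1 = μ₁ x + 1 + 1; rw [h₁₁ x])
        (fun x => by show μ₂ (x + a) + 1 = μ₂ x + 1; rw [h₂₁ x])
        (fun x => by show μ₁ (x + b) + 1 = μ₁ x + 1; rw [h₁₂ x])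
        (fun x => by show μ₂ (x + b) + 1 = μ₂ x + 1 + 1; rw [h₂₂ x])
        hquad hflatZ hl₂'
      -- the NOR-unit data
      have hμ₁' : IsAffineFn (fun x => μ₁ x + 1) := by
        intro x w
        show μ₁ (x + w) + 1 = μ₁ x + 1 + (μ₁ w + 1) + (μ₁ 0 + 1)
        rw [hμ₁]
        generalize μ₁ x = s; generalize μ₁ w = s'; generalize μ₁ 0 = s₀
        revert s s' s₀; decide
      have hμ₂' : IsAffineFn (fun x => μ₂ x + 1) := hl₂'
      have hm₁ : IsAffineFn (fun x => a₁ x + μ₂ x) := ha₁.add hμ₂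
      have hm₂ : IsAffineFn (fun x => a₂ x + 1) := by
        intro x w
        show a₂ (x + w) + 1 = a₂ x + 1 + (a₂ w + 1) + (a₂ 0 + 1)
        rw [ha₂]
        generalize a₂ x = s; generalize a₂ w = s'; generalize a₂ 0 = s₀
        revert s s' s₀; decide
      have hQ' : ∀ x, qform (B.D e) (fun j => I.vars j 2) (fun j => I.vars j 3) x + κ =
          (fun x => μ₁ x + 1) x * (fun x => a₁ x + μ₂ x) x + (fun x => μ₂ x + 1) x * (fun x => a₂ x + 1) x := by
        intro x
        have h : qDir I B mv x + 1 = (μ₁ x + 1) * a₁ x + (μ₂ x + 1) * a₂ x := hrep x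
        show qform (B.D e) (fun j => I.vars j 2) (fun j => I.vars j 3) x + κ = (μ₁ x + 1) * (a₁ x + μ₂ x) + (μ₂ x + 1) * (a₂ x + 1)
        rw [hEXC x]
        revert h
        generalize qDir I B mv x = s; generalize μ₁ x = u; generalize μ₂ x = v; generalize a₁ x = A; generalize a₂ x = A'
        generalize κ = k
        revert s u v A A' k; decide
      -- linear parts of `μᵢ + 1` are those of `μᵢ`
      have hlin : ∀ {μ : (Fin n → ZMod 2) → ZMod 2} (hμ : IsAffineFn μ) (hμ' : IsAffineFn (fun x => μ x + 1)) (y : Fin n → ZMod 2),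
          linPart hμ' y = linPart hμ y := by
        intro μ hμ hμ' y
        rw [linPart_apply, linPart_apply]
        show μ y + 1 + (μ 0 + 1) = μ y + μ 0
        generalize μ y = s; generalize μ 0 = s₀
        revert s s₀; decide
      -- the polar identity of `Q = q + μ₁μ₂ + κ`
      have hpolQ : polar (B.D e) (fun j => I.vars j 2) (fun j => I.vars j 3) = polarDir I B mv + symForm (linPart hμ₁) (linPart hμ₂) := by
        refine polar_unique hB' fun x w => ?_
        rw [hEXC (x + w), hEXC x, hEXC w, hEXC 0, hqB, affine_mul_polar hμ₁ hμ₂, LinearMap.add_apply, LinearMap.add_apply]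
        generalize qDir I B mv x = s; generalize qDir I B mv w = s'; generalize qDir I B mv 0 = s₀
        generalize polarDir I B mv x w = t; generalize μ₁ x * μ₂ x = p; generalize μ₁ w * μ₂ w = p'; generalize μ₁ 0 * μ₂ 0 = p₀
        generalize symForm (linPart hμ₁) (linPart hμ₂) x w = t'; generalize κ = k
        revert s s' s₀ t p p' p₀ t' k; decide
      -- the gadget set
      set G : Finset (Fin m) := (B.T₁ ∪ freeMon I B.N B.G₁ ∪ (B.T₂ ∪ freeMon I B.N B.G₂)).filter fun g => g ∉ insert e (B.D e) with hGdef
      have hGd : Disjoint G (insert e (B.D e)) := by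
        rw [Finset.disjoint_left]
        intro g hg
        exact (mem_filter.1 hg).2
      have hsub : insert e (B.D e) ∪ G ⊆ B.J₀ ∪ B.G₁ ∪ B.G₂ := by
        intro g hg
        rcases mem_union.1 hg with hg | hg
        · rcases mem_insert.1 hg with rfl | hg
          · exact mem_union_left _ (mem_union_left _ (hW.hN he))
          · exact mem_union_left _ (mem_union_left _ (mem_sdiff.1 (hW.hD e he hg)).1)
        · have hg' := (mem_filter.1 hg).1
          rcases mem_union.1 hg' with hg' | hg' <;> rcases mem_union.1 hg' with hg' | hg'
          · exact mem_union_left _ (mem_union_left _ (mem_sdiff.1 (hW.hT₁ hg')).1)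
          · exact mem_union_left _ (mem_union_right _ (mem_filter.1 hg').1)
          · exact mem_union_left _ (mem_union_left _ (mem_sdiff.1 (hW.hT₂ hg')).1)
          · exact mem_union_right _ (mem_filter.1 hg').1
      have hr' : (insert e (B.D e) ∪ G).card ≤ r := (card_le_card hsub).trans hr
      have hcyc := xor_not_mem_bdry_of_even I hI (hW.hDeven e he)
      have hK : ∀ v w : Fin n, v ≠ w → ¬ AndAdj I (B.D e) v w →
          linPart hμ₁' (Pi.single v 1) * linPart hμ₂' (Pi.single w 1) + linPart hμ₁' (Pi.single w 1) * linPart hμ₂' (Pi.single v 1) = 1 →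
            ∃ g ∈ G, v ∈ andPair I g ∧ w ∈ andPair I g := by
        intro v w hvw hna hdet
        rw [hlin hμ₁ hμ₁', hlin hμ₁ hμ₁', hlin hμ₂ hμ₂', hlin hμ₂ hμ₂'] at hdet
        -- evaluate the polar identity at `(e_v, e_w)`: the left side vanishes (not adjacent)
        have h := LinearMap.congr_fun (LinearMap.congr_fun hpolQ (Pi.single v 1)) (Pi.single w 1)
        rw [polar_basis I hI hS, if_neg hna, LinearMap.add_apply, LinearMap.add_apply, symForm_apply, hdet] at h
        have hval : polarDir I B mv (Pi.single v 1) (Pi.single w 1) = 1 := by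
          have e3 : ∀ t : ZMod 2, (0 : ZMod 2) = t + 1 → t = 1 := by decide
          exact e3 _ h
        obtain ⟨g, hg, hvg, hwg⟩ := exists_realiser_of_polarDir I hI hS B mv hval
        refine ⟨g, mem_filter.2 ⟨hg, fun hge => ?_⟩, hvg, hwg⟩
        rcases mem_insert.1 hge with rfl | hgD
        · rcases mem_union.1 hg with h | h <;> rcases mem_union.1 h with h | h
          · exact (mem_sdiff.1 (hW.hT₁ h)).2 he
          · exact heG (mem_union_left _ (mem_filter.1 h).1)
          · exact (mem_sdiff.1 (hW.hT₂ h)).2 he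
          · exact heG (mem_union_right _ (mem_filter.1 h).1)
        · refine hna ?_
          rw [mem_andPair_iff] at hvg hwg
          rcases hvg with rfl | rfl <;> rcases hwg with rfl | rfl
          · exact absurd rfl hvw
          · exact ⟨g, hgD, Or.inl ⟨rfl, rfl⟩⟩
          · exact ⟨g, hgD, Or.inr ⟨rfl, rfl⟩⟩
          · exact absurd rfl hvw
      obtain ⟨j₁, j₂, σ, τ, hne, hDe, hdisj, hσ, hτ, hlit, g, hg, hσg, hτg⟩ :=
        nor_unit_na hI hS hB heD hGd hr' hcyc hμ₁' hμ₂' hm₁ hm₂ hQ' hK hrank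
      refine ⟨j₁, j₂, σ, τ, hne, hDe, hdisj, hσ, hτ, fun v => ?_, g, (mem_filter.1 hg).1, hσg, hτg⟩
      rw [← hlit v, hlin hμ₁ hμ₁', hlin hμ₂ hμ₂', linPart_apply, linPart_apply]
      have e4 : ∀ s s₀ : ZMod 2, s + s₀ ≠ 0 ↔ s ≠ s₀ := by decide
      rw [e4, e4]
    · -- `d = 1`: `q_m + 1` vanishes on the hyperplane `{μ₁ = 0}`
      exfalso
      have hhyp : ∀ x, μ₁ x = 0 → qDir I B mv x + 1 = 0 := by
        intro x h1
        refine hoff x ?_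
        rw [hd1, h1, zero_mul]
        exact zero_ne_one
      obtain ⟨m₀, hm₀, hrep⟩ := exists_affine_mul_of_hyperplane hquad h₁₁ hhyp
      refine absurd hrank (not_rank_four_of_mul hB' hμ₁ (hm₀.add hμ₂) (κ := 1 + κ) fun x => ?_)
      have h : qDir I B mv x + 1 = μ₁ x * m₀ x := hrep x
      show qform (B.D e) (fun j => I.vars j 2) (fun j => I.vars j 3) x = μ₁ x * (m₀ x + μ₂ x) + (1 + κ)
      rw [hEXC x]
      revert h
      generalize qDir I B mv x = s; generalize μ₁ x = u; generalize μ₂ x = v; generalize m₀ x = A; generalize κ = k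
      revert s u v A k; decide
  · -- dependent linear parts: `μ₁μ₂` is affine
    have hα : ∃ α : (Fin n → ZMod 2) → ZMod 2, IsAffineFn α ∧ ∀ x, μ₁ x * μ₂ x = α x := by
      -- the three degenerate shapes: `μ₁` constant, `μ₂` constant, equal linear parts
      have key : ∀ {ν₁ ν₂ : (Fin n → ZMod 2) → ZMod 2}, IsAffineFn ν₁ → IsAffineFn ν₂ →
          (∀ a, ν₁ a ≠ ν₁ 0 → ν₂ a ≠ ν₂ 0) → ∃ α : (Fin n → ZMod 2) → ZMod 2, IsAffineFn α ∧ ∀ x, ν₁ x * ν₂ x = α x := by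
        intro ν₁ ν₂ hν₁ hν₂ himp
        by_cases hc : ∀ a, ν₁ a = ν₁ 0
        · exact ⟨fun x => ν₁ 0 * ν₂ x, hν₂.const_mul _, fun x => by rw [hc x]⟩
        · push Not at hc
          obtain ⟨a₀, ha₀⟩ := hc
          have hb₀ := himp a₀ ha₀
          -- the linear parts coincide
          have heq : ∀ x, ν₂ x + ν₂ 0 = ν₁ x + ν₁ 0 := by
            intro x
            rcases z01 (ν₁ x + ν₁ 0) with h0 | h1
            · -- `x + a₀` has `ν₁`-linear part `1`
              have hx1 : ν₁ (x + a₀) ≠ ν₁ 0 := by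
                rw [hν₁]
                revert h0 ha₀
                generalize ν₁ x = s; generalize ν₁ a₀ = t; generalize ν₁ 0 = s₀
                revert s t s₀; decide
              have hx2 := himp _ hx1
              rw [hν₂] at hx2
              rw [h0]
              revert hx2 hb₀
              generalize ν₂ x = s; generalize ν₂ a₀ = t; generalize ν₂ 0 = s₀
              revert s t s₀; decide
            · have hx1 : ν₁ x ≠ ν₁ 0 := by
                revert h1; generalize ν₁ x = s; generalize ν₁ 0 = s₀; revert s s₀; decide
              have hx2 := himp x hx1
              rw [h1]
              revert hx2; generalize ν₂ x = s; generalize ν₂ 0 = s₀; revert s s₀; decide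
          refine ⟨fun x => (1 + ν₁ 0 + ν₂ 0) * ν₁ x, hν₁.const_mul _, fun x => ?_⟩
          have hx := heq x
          have e5 : ∀ u v u₀ v₀ : ZMod 2, v + v₀ = u + u₀ → u * v = (1 + u₀ + v₀) * u := by decide
          exact e5 _ _ _ _ hx
      rw [not_and_or] at hind
      rcases hind with h | h
      · push Not at h
        exact key hμ₁ hμ₂ h
      · push Not at h
        obtain ⟨α, hα, hαx⟩ := key hμ₂ hμ₁ fun b hb ha => hb (h b ha)
        exact ⟨α, hα, fun x => by rw [mul_comm]; exact hαx x⟩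
    obtain ⟨α, hαaff, hα⟩ := hα
    by_cases hαc : ∀ x, α x = α 0
    · left
      exact ⟨α 0 + κ, fun x => by rw [hEXC x, hα x, hαc x, add_assoc]⟩
    · exfalso
      push Not at hαc
      obtain ⟨v, hv⟩ := hαc
      -- the hyperplane `{α + d + 1 = 0}` misses `Z`, so `q_m + 1` vanishes there
      have hlam : IsAffineFn (fun x => α x + (d + 1)) := by
        intro x w
        show α (x + w) + (d + 1) = α x + (d + 1) + (α w + (d + 1)) + (α 0 + (d + 1))
        rw [hαaff]
        generalize α x = s; generalize α w = s'; generalize α 0 = s₀; generalize d + 1 = k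
        revert s s' s₀ k; decide
      have hflip : ∀ x, (fun x => α x + (d + 1)) (x + v) = (fun x => α x + (d + 1)) x + 1 :=
        flips_of_affine hlam (by show α v + (d + 1) ≠ α 0 + (d + 1); exact fun h' => hv (add_right_cancel h'))
      have hhyp : ∀ x, (fun x => α x + (d + 1)) x = 0 → qDir I B mv x + 1 = 0 := by
        intro x hx
        refine hoff x ?_
        rw [hα x]
        have e6 : ∀ s k : ZMod 2, s + (k + 1) = 0 → s ≠ k := by decide
        exact e6 _ _ hx
      obtain ⟨m₀, hm₀, hrep⟩ := exists_affine_mul_of_hyperplane hquad hflip hhyp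
      refine absurd hrank (not_rank_four_of_mul hB' hlam (hm₀.add (isAffineFn_const 1)) (κ := d + κ) fun x => ?_)
      have h : qDir I B mv x + 1 = (α x + (d + 1)) * m₀ x := hrep x
      show qform (B.D e) (fun j => I.vars j 2) (fun j => I.vars j 3) x = (α x + (d + 1)) * (m₀ x + 1) + (d + κ)
      rw [hEXC x, hα x]
      revert h
      generalize qDir I B mv x = s; generalize α x = u; generalize m₀ x = A; generalize κ = k; generalize d = k'
      revert s u A k k'; decide

/-- **(EXC) chords of the regime theorem are CONS-T units or (EQ).**  The (★★) containment is supplied by the chord system: reads on the line of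
`m ≠ 0`, constant reads, infeasible, chord-minimal in `e` (`PstarChordSystemMap.U1_package`, `PstarChordSystem.star_star`). -/
theorem exc_unit_of_regime (I : LocalMap 4 n m) (hI : I.IsPure xorAndPred) (hS : SimpleOverlap I) {r : ℕ} (hB : BoundaryExpanding r I)
    {B : BridgeData n m} (hW : B.WF I) (hr : (B.J₀ ∪ B.G₁ ∪ B.G₂).card ≤ r) {e : Fin m} (he : e ∈ B.N) (heG : e ∉ B.G₁ ∪ B.G₂)
    {mv : V2} (hmv : mv ≠ 0)
    (hU1 : ∀ e' a, ((sys I B).ρ e' a = 0 ∨ (sys I B).ρ e' a = mv) ∧ ((sys I B).ρ' e' a = 0 ∨ (sys I B).ρ' e' a = mv))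
    (hconst : ∀ e' a a', (sys I B).ρ e' a = (sys I B).ρ e' a' ∧ (sys I B).ρ' e' a = (sys I B).ρ' e' a')
    (hinf : (sys I B).Infeasible B.N) (hmin : (sys I B).ChordMinimal B.N e)
    {μ₁ μ₂ : (Fin n → ZMod 2) → ZMod 2} (hμ₁ : IsAffineFn μ₁) (hμ₂ : IsAffineFn μ₂) {κ : ZMod 2}
    (hEXC : ∀ x, qform (B.D e) (fun j => I.vars j 2) (fun j => I.vars j 3) x = qDir I B mv x + μ₁ x * μ₂ x + κ) :
    (∃ κ' : ZMod 2, ∀ x, qform (B.D e) (fun j => I.vars j 2) (fun j => I.vars j 3) x = qDir I B mv x + κ') ∨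
    (∃ j₁ j₂ : Fin m, ∃ σ τ : Fin n, j₁ ≠ j₂ ∧ B.D e = {j₁, j₂} ∧ Disjoint (andPair I j₁) (andPair I j₂) ∧
      σ ∈ andPair I j₁ ∧ τ ∈ andPair I j₂ ∧
      (∀ v : Fin n, (μ₁ (Pi.single v 1) ≠ μ₁ 0 ∨ μ₂ (Pi.single v 1) ≠ μ₂ 0) ↔ (v = σ ∨ v = τ)) ∧
      ∃ g ∈ B.T₁ ∪ freeMon I B.N B.G₁ ∪ (B.T₂ ∪ freeMon I B.N B.G₂), σ ∈ andPair I g ∧ τ ∈ andPair I g) := by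
  obtain ⟨hSR, hinf', hmin', hconst'⟩ := U1_package (sys I B) hinf hmv hU1 hconst
  have hstar := (mapSys (sys I B) (toX mv)).star_star hSR hconst' hinf' he (hmin' e hmin)
  refine exc_unit_of_dir I hI hS hB hW hr he heG mv (fun x hx => ?_) hμ₁ hμ₂ hEXC
  have hZx : ((mapSys (sys I B) (toX mv)).F x).2 = (mapSys (sys I B) (toX mv)).t.2 := by
    have h := q_dir I B mv x
    rw [hx] at h
    have e2 : ∀ a b : ZMod 2, a + b = 0 → a = b := by decide
    exact e2 _ _ h
  have h1 := hstar x hZx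
  rw [mapSys_u, sys_u_eq I B e x] at h1
  have e1 : ∀ g Q : ZMod 2, g + Q = 1 → Q = g + 1 := by decide
  exact e1 _ _ h1

end Summit.PneNP.PneNP.Theorems.PstarNorUnitExc
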